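import Literature.MathematicalPhysics.QuantumFieldTheory.Balaban1983to89.T4MatchingClosureSocket

/-!
# `T4Continuum.Support.WeightRouteJunction` — node U5 (NE7), road P3-W «weight route»: JUNCTION J1 — the owner road
P1's term-wise END shape `GoodClause` on the hybrid cores meets the weight-and-remnant half on a TAIL of cutoffs

(cell `pub-balaban`, BINDER-OWNERS row NE7 co-owner #3 `b2b-balaban-t4-ne7-p3`, ROUND-2 skeleton
`t4/skeletons/NE7-t4-ne7-p3.md` §4 stub (s7) / §6 junction finding J1; kernel bookkeeping only.)

HONEST FRAMING (T4-DAG PAGE 1).  Fixed finite T⁴, rung (B)+1 (existence AND uniqueness of the `ε → 0` limit of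
unit-scale averaged gauge-invariant expectations), CONDITIONAL on BetaPertH and the nine spine estimates (0/9 proved);
NOT infinite volume, NOT the mass gap, NOT the Clay problem.  This module proves NO estimate.  It records, as kernel
bookkeeping, how the two halves of node U5 meet: road P1 (row NE7 owner `b2b-balaban-t4-ne7-p1`) delivers its END in
the shape `T4GoodClassBudget.GoodClause l₀ vol T A B Bad δ ∧ Summable δ` (`SKELETON-NE7-P1.md` §0); road P3-W (this
seat) delivers ANY `RelWeightBound` (NE7b socket), ANY `ShellWeightBound` (NE7c socket) and the remnant clause
`RemnantAgeBound` + a sub-linear young allowance (`t4/skeletons/NE7-t4-ne7-p3.md` §0).  §1: the landed bridge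
`T4MatchingClosure.hybridNE7_of_goodClause_shell` MINUS its weight-condition binder `hlt` (the condition holds on a
tail, `T4MatchingClosure.eventually_budget_lt_one`): `GoodClause` on the hybrid cores + the two weight structures ⇒
`∃ K₀, HybridNE7` for the `K₀`-shifted families.  §2 (= junction J1): the same with the term-wise remainder
`δ := δ′ + C_y·remnantYoungW θ Λ C Wy + remnantOld remOld Λ C C′` — road P1's columns `δ′` (summable by P1) plus the
two remnant columns of road P3-W (summable by `T4MatchingClosureRem.summable_add_remnantYoungW` /
`summable_add_remnantOld` from `RemnantAgeBound`, `SublinearWindow` and the window arithmetic).  Every analytic input is a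
BINDER; nothing of Bałaban's is asserted or instantiated.
HONEST DEPENDENCY: continuum YM on T⁴ ⇐ BetaPertH ∧ nine spine estimates (0/9 proved); BetaPertH ⇐ (D1) ∧ (D4) ∧
CAP+tail; G-an2-4 gates asym, D1 and NE2/3/4.
-/

open Finset

namespace Summit.QuantumFields.BalabanUV.T4Continuum.WeightRoute

open Literature.MathematicalPhysics.QuantumFieldTheory.Balaban1983to89
open Literature.MathematicalPhysics.QuantumFieldTheory.Balaban1983to89.T4WeightBudget
open Literature.MathematicalPhysics.QuantumFieldTheory.Balaban1983to89.T4IndicatorShell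
open Literature.MathematicalPhysics.QuantumFieldTheory.Balaban1983to89.T4GoodClassBudget
open Literature.MathematicalPhysics.QuantumFieldTheory.Balaban1983to89.T4MatchingAssembly
open Literature.MathematicalPhysics.QuantumFieldTheory.Balaban1983to89.T4MatchingClosure
open Literature.MathematicalPhysics.QuantumFieldTheory.Balaban1983to89.T4RemnantBooking
open Literature.MathematicalPhysics.QuantumFieldTheory.Balaban1983to89.T4MatchingClosureRem
open Literature.MathematicalPhysics.QuantumFieldTheory.Balaban1983to89.T4MatchingClosureSocket

variable {ι : Type*} [DecidableEq ι] {l₀ vol : ℝ} {T : ℕ → Finset ι} {A B shA shB : ℕ → ℝ → ι → ℝ}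
  {Bad : ℕ → ℝ → Finset ι} {W Wsh δ δ' : ℕ → ℝ} {remOld : ℕ → ℕ → ℝ} {Λ C C' E₀ ρ θ Cy : ℝ} {Wy : ℕ → ℕ}

/-! ## §1 The bridge on a tail: `GoodClause` on the hybrid cores + the two weight structures ⇒ `∃ K₀, HybridNE7` -/

/-- `GoodClause` is stable under the origin shift `K ↦ K₀ + K` (every clause is per `K`). [folklore] -/
theorem goodClause_shift (K₀ : ℕ) {Ac Bc : ℕ → ℝ → ι → ℝ} (h : GoodClause l₀ vol T Ac Bc Bad δ) :
    GoodClause l₀ vol (fun K => T (K₀ + K)) (fun K => Ac (K₀ + K)) (fun K => Bc (K₀ + K)) (fun K => Bad (K₀ + K))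
      fun K => δ (K₀ + K) :=
  fun K => h (K₀ + K)

/-- **THE BRIDGE ON A TAIL** (`T4MatchingClosure.hybridNE7_of_goodClause_shell` minus `hlt`): ANY NE7b datum
`RelWeightBound … W`, ANY NE7c datum `ShellWeightBound … shA shB Wsh`, a summable term-wise remainder `δ` and road P1's
END shape `GoodClause` ON THE HYBRID CORES `A − shA`, `B − shB` ⇒ the `K₀`-shifted families carry a `HybridNE7` datum
for some `K₀` (the weight condition `W K + Wsh K < 1` holds from `K₀` on by the two structures' own `summable` fields).
CONDITIONAL on every binder; nothing PRINTED is asserted. [folklore] -/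
theorem hybridNE7_tail_of_goodClause (hW : RelWeightBound l₀ T A B Bad W) (hSh : ShellWeightBound l₀ T A B shA shB Wsh)
    (hδ : Summable δ)
    (hcore : GoodClause l₀ vol T (fun K t τ => A K t τ - shA K t τ) (fun K t τ => B K t τ - shB K t τ) Bad δ) :
    ∃ K₀, HybridNE7 l₀ vol (fun K => T (K₀ + K)) (fun K => A (K₀ + K)) (fun K => B (K₀ + K)) (fun K => Bad (K₀ + K))
      (fun K => W (K₀ + K)) (fun K => shA (K₀ + K)) (fun K => shB (K₀ + K)) (fun K => Wsh (K₀ + K))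
      (fun K => δ (K₀ + K)) := by
  obtain ⟨K₀, hK₀⟩ := eventually_budget_lt_one hW.summable hSh.summable
  refine ⟨K₀, hybridNE7_of_goodClause_shell (relWeightBound_shift K₀ hW) (shellWeightBound_shift K₀ hSh)
    (fun K => hK₀ (K₀ + K) (Nat.le_add_right K₀ K)) (hδ.comp_injective (add_right_injective K₀)) ?_⟩
  exact goodClause_shift K₀ hcore

/-! ## §2 Junction J1: road P1's columns `δ′` plus road P3-W's two remnant columns -/

/-- **JUNCTION J1 (roads P1 and P3-W meet in `HybridNE7.core`).**  If road P1's good clause on the hybrid cores holds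
with the term-wise remainder `δ′ K + C_y·remnantYoungW θ Λ C Wy K + remnantOld remOld Λ C C′ K` — its own columns `δ′`
(summable: P1's END) plus the YOUNG remnant column at the birth-scale rate and the OLD remnant column by size — and
road P3-W supplies ANY `RelWeightBound`, ANY `ShellWeightBound`, the remnant clause `RemnantAgeBound remOld E₀ ρ` with
`1 ≤ Λ`, `0 ≤ C`, `0 ≤ E₀`, `0 < ρ < 1`, `⌈C log Λ⌉₊ + 3 ≤ C′(−log ρ)`, `0 < θ < 1` and a sub-linear young allowance
`Wy`, then `∃ K₀, HybridNE7` for the shifted families with that remainder.  (`summable_add_remnantYoungW`,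
`summable_add_remnantOld`, then §1.)  CONDITIONAL; nothing PRINTED is asserted; road P1's `GoodClause` with the remnant
columns inside is NOT claimed producible here — that is the content of finding J1. [folklore] -/
theorem hybridNE7_tail_of_goodClause_remnantW (hW : RelWeightBound l₀ T A B Bad W)
    (hSh : ShellWeightBound l₀ T A B shA shB Wsh) (hδ' : Summable δ')
    (hRem : RemnantAgeBound remOld E₀ ρ) (hΛ : 1 ≤ Λ) (hC : 0 ≤ C) (hE : 0 ≤ E₀) (hρ0 : 0 < ρ) (hρ1 : ρ < 1)
    (hq : ((⌈C * Real.log Λ⌉₊ : ℕ) : ℝ) + 3 ≤ C' * (-Real.log ρ)) (hθ : 0 < θ) (hθ1 : θ < 1)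
    (hWy : SublinearWindow Wy)
    (hcore : GoodClause l₀ vol T (fun K t τ => A K t τ - shA K t τ) (fun K t τ => B K t τ - shB K t τ) Bad
      fun K => (δ' K + Cy * remnantYoungW θ Λ C Wy K) + remnantOld remOld Λ C C' K) :
    ∃ K₀, HybridNE7 l₀ vol (fun K => T (K₀ + K)) (fun K => A (K₀ + K)) (fun K => B (K₀ + K)) (fun K => Bad (K₀ + K))
      (fun K => W (K₀ + K)) (fun K => shA (K₀ + K)) (fun K => shB (K₀ + K)) (fun K => Wsh (K₀ + K))
      (fun K => (δ' (K₀ + K) + Cy * remnantYoungW θ Λ C Wy (K₀ + K)) + remnantOld remOld Λ C C' (K₀ + K)) := by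
  have h1 : Summable fun K => δ' K + Cy * remnantYoungW θ Λ C Wy K :=
    summable_add_remnantYoungW hδ' hθ hθ1 hΛ hC hWy
  have h2 : Summable fun K => (δ' K + Cy * remnantYoungW θ Λ C Wy K) + remnantOld remOld Λ C C' K :=
    summable_add_remnantOld h1 hΛ hC hE hρ0 hρ1 hRem hq
  exact hybridNE7_tail_of_goodClause hW hSh h2 hcore

end Summit.QuantumFields.BalabanUV.T4Continuum.WeightRoute
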